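import Summits.QuantumFields.YangMills.Theorems.CovariantDischargeDoorReading
import Summits.QuantumFields.YangMills.Theorems.CovariantDischargeCombLassoStokes
import Summits.QuantumFields.YangMills.Theorems.CovariantDischargeDirectionNet
import Summits.QuantumFields.YangMills.Theorems.CovariantDischargeDoorSites
import Summits.QuantumFields.YangMills.Theorems.BalabanUVNodesN21ReadSetSupport
import Literature.MathematicalPhysics.QuantumFieldTheory.Balaban1983to89.T3UnitLawDensityEML
import HarnessLib

/-!
# Line «sandwich_discharge» on crux `HistoryTailL` (stmt-QuantumFields-19936), stub `stub_sandwichSweepGapCapped` (S′), B6 door leaves (S3)(S4)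
# «D6-MEANS»: the one-stroke mean of the comb-gauged plaquette readings over the translated-square family of a level-`k` plaquette IS the window
# statistic of the `k`-fold averaged plaquette (conjugated by the restricted comb gauge), to second order in the comb-lasso letter `β_k`

Cell `ym3-torus` (YM ladder rung R3 = continuum SU(2) Yang–Mills on the three-torus — a RUNG, NOT the Clay problem); width seat `ym3-torus-px18` gen 6;
`--supports stmt-QuantumFields-19936` (helper).  THEOREMS ONLY (0 `def`, default heartbeats).

WHY (px8 g7 DOOR SKELETON v3 `DOOR-SKELETON-px8g7.lean` f02daf0d, leaves (S3) `D6-MEANS(j)` and (S4) `D6-MEANS(h)`; px8 g8 13:56:57Z offer (3)).  The door reads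
its SIGNAL through the antisymmetrised plaquette reading `Φ` of the comb-gauged field `W̃ := V^{axialT V c₀}` (leaf (S0), `Φ q.src q.μ q.ν = ⟪v, imVec su2Quat(W̃(∂q))⟫`)
averaged over the one-stroke family of the signal plaquette `p` (height `j`) and of the far plaquette `P″` (height `h`).  ✓`CovariantDischargeDoorReading` supplies
the two analytic rows (localised reading `reading_conj_iter_plaqHol_le`; plaquette-vs-linear reading inside the mean `abs_mean_reading_sub_mean_lin_le`) modulo
a link bound on a bond set `B` carrying the averaging inputs (`feeds`) of the four bonds of the plaquette and the one-stroke links; ✓`CovariantDischargeCombLassoStokes.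
dist1_gaugeAct_axialT_le_of_ball` IS that bound on the ball `B := {b | b.src = c₀ + z, ‖z‖∞ ≤ 4L^k + 2}` with `β_k := ((2d(4L^k+2)+2)²∕4)·θK` under `PlaqSmall θK V`;
THIS FILE does the torus bookkeeping that puts the inputs in that ball for ANY `c₀` in the `k`-block of the plaquette's source (so the same radius serves
`k = j`, `c₀ = embIter j p.src`, and `k = h`, `P″.src = blockIter h c₀`), and knits:
* §1 `cover_eq_transl`, `exists_transl_of_mem_feeds` (every averaging input of a bond `c` with `c₋ ∈ {y, y + e_κ}`, `y` the `k`-block of `c₀`, has source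
  `c₀ + z`, `‖z‖∞ ≤ 4L^k − 3` — ✓`N21ReadSetSupport.feeds_witness` + the `L^k`-translate), `exists_transl_of_mem_iterBlock` (one-stroke sites: `‖z‖∞ ≤ 2L^k − 2`);
* §2 ★★ `abs_mean_sub_reading_conj_le` — any `P`, height `k` (`k + 2 ≤ m + K`), ONE guard `81ℓ(4ℓ)^k β_k ≤ 1` (`ℓ = (d+2)L`; it implies the reading lemma's
  `2ℓ(4ℓ)^kβ_k < δ₂` and `β_k ≤ 1`): `|MEAN_k(Φ) − ⟪v, imVec su2Quat(u^{(k)}(y)·Ū^k[V](∂⟨y,μ,ν⟩)·u^{(k)}(y)⁻¹)⟫| ≤ √3·13β_k²·(L^k)² + √3·100·(4ℓ)^{2k}·β_k²` (`‖v‖ = 1`);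
* §3 the door's leaves VERBATIM in the skeleton's letters: ★ `door_mean_le` = (S3) (`k = j`, `u^{(j)}(p.src) = 1` by ✓`transfUp_axialT_embIter`) and
  ★ `door_mean_far_le` = (S4) (`k = h`, the far plaquette's nesting identity `val(p.src i)∕L^{h−j} = val(Y i)`, `|⟪v, imVec su2Quat(uXu⁻¹)⟫| ≤ dist1 X < x_h`
  from `PlaqSmall x_h (Ū^h V)` — the stub's `hcoarse h`).
HONEST SCOPE: reading rows of D6; nothing of the action side, the profile, (η), S′∕`stub_sandwichSweepGapCapped`∕`HistoryTailL` proved or claimed; YM₃ on T³ is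
rung R3, not d = 4, not Clay. [cite: Balaban1985Averaging, (11)-(12) p.19, (19)-(20) p.21, Prop. 1 (51) p.26; Balaban1988Convergent, (2.11) p.256; Balaban1987RG1, (0.1) p.251]
-/

noncomputable section

open scoped BigOperators Matrix.Norms.L2Operator RealInnerProductSpace

namespace Summit.QuantumFields.YangMills.Theorems.CovariantDischargeDoorMeans

open Literature.MathematicalPhysics.QuantumFieldTheory.Balaban1983to89
open Literature.MathematicalPhysics.QuantumLattice (su2Quat)
open Literature.MathematicalPhysics.QuantumFieldTheory.Balaban1983to89.T4ExpWindowSmallField (imVec)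
open T4Continuum (transfUp)
open B10Eq27TorusAxialLog (transl transl_apply transl_add_e axialT)
open B5Eq118OneStroke (iterBlock mem_iterBlock_iff)
open B14.Eq216Concrete (feeds)
open B14.Eq22Determines (blockIter)
open B14.Eq213DetSet (val_blockIter)
open B15DeterminingSets (embIter)
open B15Eq112TorusCover (cover lift per cover_lift cover_add_pmul cover_eq_cover_iff cover_apply)
open B15LatticeCubeTorus (pmul)
open B14DomainGeom (Within Pt)
open LatticeFieldCalculus (runSite runSite_succ runSite_zero)
open ExpMeanLog (deltaSU)
open Summit.QuantumFields.YangMills.Theorems.N21ReadSetSupport (feeds_witness within_lift_of_blockIter_eq blockIter_embIter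
  blockIter_cover_sub_single eq_of_shift_eq within_sub_single)
open Summit.QuantumFields.YangMills.Theorems.CovariantDischargeDoorReading (reading_conj_iter_plaqHol_le abs_mean_reading_sub_mean_lin_le)
open Summit.QuantumFields.YangMills.Theorems.CovariantDischargeCombLassoStokes (dist1_gaugeAct_axialT_le_of_ball)
open Summit.QuantumFields.YangMills.Theorems.CovariantDischargeDirectionNet (norm_imVec_le_dist1)
open Summit.QuantumFields.YangMills.Theorems.CovariantDischargeAvgPlaqFluxReading (sum_abs_le_sqrt_three_mul_norm)
open Summit.QuantumFields.YangMills.Theorems.CovariantDischargeDoorSites (transfUp_axialT_embIter val_embIter_div_pow)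

variable {P : Params}

/-! ## §1 Torus bookkeeping: the averaging inputs and the one-stroke sites lie in the ball about any point of the block -/

/-- `π x = c₀ + (x − lift c₀)` on the torus: every cover point is an integer translate of any base site. [cite: Balaban1987RG1, (0.1) p.251] -/
theorem cover_eq_transl (c₀ : Site P 0) (x : Pt P.d) : cover P x = transl c₀ (x - lift P c₀) := by
  funext ν
  simp only [cover_apply, transl_apply, lift, Pi.sub_apply, Int.cast_sub, Int.cast_natCast, ZMod.natCast_zmod_val]
  abel

/-- `Within` is translation invariant. [folklore] -/
private theorem within_add_right {d : ℕ} {r : ℤ} {x y : Pt d} (h : Within r x y) (t : Pt d) : Within r (x + t) (y + t) := fun i => by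
  simp only [Pi.add_apply, add_sub_add_right_eq_sub]; exact h i

/-- ★ **THE AVERAGING INPUTS IN THE BALL**: if `c₀` lies in the `k`-block `y := blockIter k c₀` (`k ≤ m + K`) and `c` is a level-`k` bond issuing from `y` or from a
neighbour `y + e_κ`, every fine bond `b₀ ∈ feeds k c` has `b₀.src = c₀ + z` with `‖z‖∞ ≤ 4L^k − 3` (✓`feeds_witness`: within `2L^k − 2` of a cover point of the block of
`c₋`; same block: `L^k − 1`; the neighbour's block is the `L^k`-translate). [cite: Balaban1988Convergent, (2.11) p.256] -/
theorem exists_transl_of_mem_feeds {k : ℕ} (hk : k ≤ P.m + P.K) (c₀ : Site P 0) (c : PBond P k)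
    (hc : c.src = blockIter k c₀ ∨ ∃ κ, c.src = (blockIter k c₀).shift κ) {b₀ : PBond P 0} (hb₀ : b₀ ∈ feeds k c) :
    ∃ z : Fin P.d → ℤ, (∀ ν, (z ν).natAbs ≤ 4 * P.L ^ k - 3) ∧ b₀.src = transl c₀ z := by
  obtain ⟨x, x₀, hx, hx₀, hw⟩ := feeds_witness hk c b₀ hb₀
  have hq : 1 ≤ P.L ^ k := Nat.one_le_pow _ _ P.L_pos
  -- a cover point `x'` of the block of `c₀` within `L^k` of `x`
  obtain ⟨x', hx', hxx'⟩ : ∃ x' : Pt P.d, blockIter k (cover P x') = blockIter k c₀ ∧ Within ((P.L ^ k : ℕ) : ℤ) x' x := by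
    rcases hc with h | ⟨κ, h⟩
    · exact ⟨x, hx.trans h, Within.refl (Int.natCast_nonneg _) x⟩
    · refine ⟨x - Pi.single κ ((P.L ^ k : ℕ) : ℤ), ?_, ?_⟩
      · have h1 := blockIter_cover_sub_single hk x κ
        rw [hx, h] at h1
        exact eq_of_shift_eq h1
      · exact (within_sub_single x κ (Int.natCast_nonneg _)).symm
  have hW1 : Within (((P.L ^ k : ℕ) : ℤ) - 1) (lift P (cover P x')) (lift P c₀) := within_lift_of_blockIter_eq hk hx'
  obtain ⟨v, hv⟩ : ∃ v, lift P (cover P x') = x' + pmul (per P) v :=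
    (cover_eq_cover_iff x' (lift P (cover P x'))).1 (cover_lift (cover P x')).symm
  have hW2 : Within (2 * ((P.L ^ k : ℕ) : ℤ) - 2) (x + pmul (per P) v) (x₀ + pmul (per P) v) := within_add_right hw _
  have hW3 : Within ((P.L ^ k : ℕ) : ℤ) (lift P (cover P x')) (x + pmul (per P) v) := by
    rw [hv]; exact within_add_right hxx' _
  have hsum : (((P.L ^ k : ℕ) : ℤ) - 1) + ((((P.L ^ k : ℕ) : ℤ)) + (2 * ((P.L ^ k : ℕ) : ℤ) - 2)) ≤ 4 * ((P.L ^ k : ℕ) : ℤ) - 3 := by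
    omega
  have hW : Within (4 * ((P.L ^ k : ℕ) : ℤ) - 3) (lift P c₀) (x₀ + pmul (per P) v) :=
    Within.mono hsum (hW1.symm.triangle (hW3.triangle hW2))
  refine ⟨x₀ + pmul (per P) v - lift P c₀, fun ν => ?_, by rw [← cover_eq_transl, cover_add_pmul, hx₀]⟩
  have h1 : |(x₀ + pmul (per P) v - lift P c₀) ν| ≤ 4 * ((P.L ^ k : ℕ) : ℤ) - 3 := by
    have := hW ν
    rw [abs_sub_comm] at this
    simpa only [Pi.sub_apply] using this
  have h3 : ((4 * P.L ^ k - 3 : ℕ) : ℤ) = 4 * ((P.L ^ k : ℕ) : ℤ) - 3 := by omega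
  have h2 : (((x₀ + pmul (per P) v - lift P c₀) ν).natAbs : ℤ) ≤ ((4 * P.L ^ k - 3 : ℕ) : ℤ) := by
    rw [Int.natCast_natAbs, h3]
    exact h1
  exact_mod_cast h2

/-- ★ **THE ONE-STROKE SITES IN THE BALL**: for `x` in the `k`-block `y = blockIter k c₀` (`k ≤ m + K`), `s, t < L^k`, `μ ≠ ν`: the site `x + s e_μ + t e_ν` is
`c₀ + z` with `‖z‖∞ ≤ 2L^k − 2` (labels of `x` and `c₀` share the `L^k`-quotient). [cite: Balaban1984PropagatorsI, (1.18) p.20] -/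
theorem exists_transl_of_mem_iterBlock {k : ℕ} (hk : k ≤ P.m + P.K) (c₀ : Site P 0) (y : Site P k) (hy : blockIter k c₀ = y)
    {x : Site P 0} (hx : x ∈ iterBlock k y) {μ ν : Fin P.d} (hμν : μ ≠ ν) {s t : ℕ} (hs : s < P.L ^ k) (ht : t < P.L ^ k) :
    ∃ z : Fin P.d → ℤ, (∀ κ, (z κ).natAbs ≤ 2 * P.L ^ k - 2) ∧ runSite (runSite x μ s) ν t = transl c₀ z := by
  rw [mem_iterBlock_iff hk] at hx
  refine ⟨fun κ => ((x κ).val : ℤ) - ((c₀ κ).val : ℤ) + (if κ = μ then (s : ℤ) else 0) + (if κ = ν then (t : ℤ) else 0),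
    fun κ => ?_, ?_⟩
  · show (((x κ).val : ℤ) - ((c₀ κ).val : ℤ) + (if κ = μ then (s : ℤ) else 0) + (if κ = ν then (t : ℤ) else 0)).natAbs ≤ 2 * P.L ^ k - 2
    -- the two labels share the quotient by `L^k`
    have h1 : (x κ).val / P.L ^ k = (c₀ κ).val / P.L ^ k := by rw [hx κ, ← hy, val_blockIter hk]
    have hq : 1 ≤ P.L ^ k := Nat.one_le_pow _ _ P.L_pos
    have hs' := hs
    have ht' := ht
    generalize P.L ^ k = N at h1 hs' ht' hq ⊢
    have h2 := Nat.div_add_mod (x κ).val N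
    have h3 := Nat.div_add_mod (c₀ κ).val N
    have h4 := Nat.mod_lt (x κ).val (by omega : 0 < N)
    have h5 := Nat.mod_lt (c₀ κ).val (by omega : 0 < N)
    rw [h1] at h2
    generalize N * ((c₀ κ).val / N) = q at h2 h3
    generalize (x κ).val % N = rx at h2 h4
    generalize (c₀ κ).val % N = rc at h3 h5
    have key : |((x κ).val : ℤ) - ((c₀ κ).val : ℤ) + (if κ = μ then (s : ℤ) else 0) + (if κ = ν then (t : ℤ) else 0)| ≤
        ((2 * N - 2 : ℕ) : ℤ) := by
      rw [abs_le]
      by_cases hκμ : κ = μ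
      · subst hκμ
        rw [if_pos rfl, if_neg hμν]
        constructor <;> omega
      · rw [if_neg hκμ]
        by_cases hκν : κ = ν
        · rw [if_pos hκν]; constructor <;> omega
        · rw [if_neg hκν]; constructor <;> omega
    have hcast : (((((x κ).val : ℤ) - ((c₀ κ).val : ℤ) + (if κ = μ then (s : ℤ) else 0) + (if κ = ν then (t : ℤ) else 0)).natAbs : ℕ) : ℤ) ≤
        ((2 * N - 2 : ℕ) : ℤ) := by
      rw [Int.natCast_natAbs]; exact key
    exact_mod_cast hcast
  · funext κ
    simp only [runSite, transl_apply, Function.update_apply]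
    by_cases hκν : κ = ν
    · subst hκν
      rw [if_pos rfl, if_neg (Ne.symm hμν), if_neg (Ne.symm hμν), if_pos rfl]
      push_cast
      rw [ZMod.natCast_zmod_val, ZMod.natCast_zmod_val]
      ring
    · rw [if_neg hκν, if_neg hκν]
      by_cases hκμ : κ = μ
      · subst hκμ
        rw [if_pos rfl, if_pos rfl]
        push_cast
        rw [ZMod.natCast_zmod_val, ZMod.natCast_zmod_val]
        ring
      · rw [if_neg hκμ, if_neg hκμ]
        push_cast
        rw [ZMod.natCast_zmod_val, ZMod.natCast_zmod_val]
        ring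

/-! ## §2 The one-stroke mean of the plaquette readings against the conjugated window statistic -/

/-- `2∕81 < δ₂(SU(2)) = min (1∕3) (π∕2)`. [folklore] -/
private theorem two_div_lt_deltaSU : (2 : ℝ) / 81 < deltaSU (Fin 2) := by
  unfold deltaSU
  rw [Fintype.card_fin]
  refine lt_min (by norm_num) ?_
  have := Real.pi_gt_three
  push_cast
  linarith

/-- Real knit: `|a − c| ≤ |a − b| + |c − b|` with a common factor `s ≤ t` pulled up. [folklore] -/
private theorem abs_sub_le_of_two_readings {a b c s t A B Y : ℝ} (h2 : |a - b| ≤ s * A * B) (h1 : |c - b| ≤ s * Y) (hst : s ≤ t)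
    (hA : 0 ≤ A) (hB : 0 ≤ B) (hY : 0 ≤ Y) : |a - c| ≤ t * A * B + t * Y := by
  have h3 : |a - c| ≤ |a - b| + |b - c| := abs_sub_le a b c
  rw [abs_sub_comm b c] at h3
  have h4 : s * A * B ≤ t * A * B := by
    have := mul_le_mul_of_nonneg_right hst (mul_nonneg hA hB)
    nlinarith
  have h5 : s * Y ≤ t * Y := mul_le_mul_of_nonneg_right hst hY
  linarith

/-- ★★ **THE ONE-STROKE MEAN OF THE COMB-GAUGED PLAQUETTE READINGS IS THE CONJUGATED WINDOW STATISTIC, TO SECOND ORDER.**  `V` a fine `SU(2)` field with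
`PlaqSmall θK V`; `c₀` a fine site in the `k`-block `y` (`k + 2 ≤ m + K`); `Φ` any function with `Φ q.src q.μ q.ν = ⟪v, imVec su2Quat(W̃(∂q))⟫` on plaquettes,
`W̃ := V^{axialT V c₀}`, `‖v‖ = 1`; ONE guard `81·ℓ·((4ℓ)^k·β_k) ≤ 1`, `ℓ := (d+2)L`, `β_k := ((2d(4L^k+2)+2)²∕4)·θK` (the comb-lasso letter on the ball of radius
`4L^k+2` about `c₀`, ✓`dist1_gaugeAct_axialT_le_of_ball`).  Then
`|(L^{dk})⁻¹·Σ_{x ∈ B^k(y)} Σ_{s,t<L^k} Φ (x + s e_μ + t e_ν) μ ν − ⟪v, imVec su2Quat(u^{(k)}(y)·Ū^k[V](∂⟨y,μ,ν⟩)·u^{(k)}(y)⁻¹)⟫| ≤ √3·13β_k²·(L^k)² + √3·100·((4ℓ)^k)²·β_k²`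
(`u := axialT V c₀`; ✓`reading_conj_iter_plaqHol_le` + ✓`abs_mean_reading_sub_mean_lin_le` on the ball, whose inputs §1 localises).
[cite: Balaban1985Averaging, (11)-(12) p.19, (19)-(20) p.21, Prop. 1 (51) p.26; Balaban1988Convergent, (2.11) p.256] -/
theorem abs_mean_sub_reading_conj_le {k : ℕ} (hk2 : k + 2 ≤ P.m + P.K)
    (V : GaugeField P 0 (Matrix.specialUnitaryGroup (Fin 2) ℂ)) {θK : ℝ} (hV : PlaqSmall θK V)
    (hguard : 81 * ((((P.d + 2) * P.L : ℕ) : ℝ)) * ((4 * ((((P.d + 2) * P.L : ℕ) : ℝ))) ^ k *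
      ((((2 * P.d * (4 * P.L ^ k + 2) + 2 : ℕ) : ℝ) ^ 2 / 4) * θK)) ≤ 1)
    (c₀ : Site P 0) (y : Site P k) (hy : blockIter k c₀ = y) (μ ν : Fin P.d) (hμν : μ < ν)
    (v : EuclideanSpace ℝ (Fin 3)) (hv : ‖v‖ = 1) (Φ : Site P 0 → Fin P.d → Fin P.d → ℝ)
    (hΦ : ∀ q : Plaq P 0, Φ q.src q.μ q.ν =
      ⟪v, imVec (su2Quat (GaugeField.plaqHol (GaugeField.gaugeAct (axialT V c₀) V) q))⟫) :
    |(((P.L : ℝ) ^ P.d) ^ k)⁻¹ * ∑ x ∈ iterBlock k y, ∑ s ∈ Finset.range (P.L ^ k), ∑ t ∈ Finset.range (P.L ^ k),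
        Φ (runSite (runSite x μ s) ν t) μ ν -
      ⟪v, imVec (su2Quat (transfUp (axialT V c₀) k y *
        GaugeField.plaqHol (Averaging.iter (fun i => BlockAveraging.blockAvg (P := P) (j := i) T3UnitLawDensityEML.ℰp) k V) ⟨y, μ, ν, hμν⟩ *
        (transfUp (axialT V c₀) k y)⁻¹))⟫| ≤
      Real.sqrt 3 * (13 * ((((2 * P.d * (4 * P.L ^ k + 2) + 2 : ℕ) : ℝ) ^ 2 / 4) * θK) ^ 2) * ((P.L : ℝ) ^ k) ^ 2 +
      Real.sqrt 3 * (100 * ((4 * ((((P.d + 2) * P.L : ℕ) : ℝ))) ^ k) ^ 2 * ((((2 * P.d * (4 * P.L ^ k + 2) + 2 : ℕ) : ℝ) ^ 2 / 4) * θK) ^ 2) := by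
  classical
  have hk : k ≤ P.m + P.K := by omega
  -- letters
  set ℓ : ℝ := (((P.d + 2) * P.L : ℕ) : ℝ) with hℓ_def
  set r : ℕ := 4 * P.L ^ k + 2 with hr_def
  set β : ℝ := (((2 * P.d * r + 2 : ℕ) : ℝ) ^ 2 / 4) * θK with hβ_def
  set u : GaugeTransf P 0 (Matrix.specialUnitaryGroup (Fin 2) ℂ) := axialT V c₀ with hu_def
  set W : GaugeField P 0 (Matrix.specialUnitaryGroup (Fin 2) ℂ) := GaugeField.gaugeAct u V with hW_def
  -- the threshold is positive (some plaquette is within `θK`), so `β ≥ 0`; from the ONE guard: `β ≤ 1∕81`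
  have hθK : 0 < θK := lt_of_le_of_lt (GaugeGroup.dist1_nonneg _) (hV ⟨c₀, μ, ν, hμν⟩)
  have hβ0 : 0 ≤ β := by rw [hβ_def]; positivity
  have hℓ1 : 1 ≤ ℓ := by
    rw [hℓ_def]
    have h1 : 1 ≤ (P.d + 2) * P.L := Nat.one_le_iff_ne_zero.mpr (Nat.mul_ne_zero (by omega) (by have := P.L_pos; omega))
    exact_mod_cast h1
  have h4ℓ : 1 ≤ (4 * ℓ) ^ k := one_le_pow₀ (by linarith)
  have hβ81 : β ≤ 1 / 81 := by
    have h1 : β ≤ (4 * ℓ) ^ k * β := le_mul_of_one_le_left hβ0 h4ℓ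
    have h2 : (4 * ℓ) ^ k * β ≤ ℓ * ((4 * ℓ) ^ k * β) := le_mul_of_one_le_left (by positivity) hℓ1
    linarith [hguard]
  have hβ1 : β ≤ 1 := hβ81.trans (by norm_num)
  have hN : 2 * (ℓ * ((4 * ℓ) ^ k * β)) < deltaSU (Fin 2) := by
    have h1 : 2 * (ℓ * ((4 * ℓ) ^ k * β)) ≤ 2 / 81 := by linarith [hguard]
    exact lt_of_le_of_lt h1 two_div_lt_deltaSU
  -- no wrap on the ball of radius `r` (`L ≥ 3`, `k + 2 ≤ m + K`)
  have hwrap : 2 * (r + 1) ≤ P.sitesPerDir 0 := by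
    have hL3 : 3 ≤ P.L := by obtain ⟨t, ht⟩ := P.hL.1; have := P.hL.2; omega
    have hspd : P.sitesPerDir 0 = 2 * P.L ^ (P.m + P.K) := by simp [Params.sitesPerDir]
    have h1 : P.L ^ (k + 2) ≤ P.L ^ (P.m + P.K) := Nat.pow_le_pow_right P.L_pos hk2
    have h2 : P.L ^ (k + 2) = P.L ^ k * (P.L * P.L) := by ring
    have h3 : 9 ≤ P.L * P.L := by nlinarith
    have h4 : P.L ^ k * 9 ≤ P.L ^ k * (P.L * P.L) := Nat.mul_le_mul_left _ h3
    have h5 : 1 ≤ P.L ^ k := Nat.one_le_pow _ _ P.L_pos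
    rw [hspd, hr_def]
    omega
  -- the ball of radius `r` about `c₀` and its comb-lasso link bound `β`
  set B : Set (PBond P 0) := {b | ∃ z : Fin P.d → ℤ, (∀ κ, (z κ).natAbs ≤ r) ∧ b.src = transl c₀ z} with hB_def
  have hB : ∀ b ∈ B, ‖((W b : Matrix.specialUnitaryGroup (Fin 2) ℂ) : Matrix (Fin 2) (Fin 2) ℂ) - 1‖ ≤ β := by
    rintro b ⟨z, hz, hb⟩
    exact dist1_gaugeAct_axialT_le_of_ball hθK.le hV c₀ hwrap hz b hb
  have mem_of : ∀ {x' : Site P 0} {z : Fin P.d → ℤ}, (∀ κ, (z κ).natAbs ≤ r) → x' = transl c₀ z →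
      ∀ κ', (⟨x', κ'⟩ : PBond P 0) ∈ B := fun hz hx' κ' => ⟨_, hz, hx'⟩
  -- the averaging inputs of the four bonds of `⟨y, μ, ν⟩` lie in the ball (§1)
  have hfeed : ∀ c : PBond P k, (c.src = blockIter k c₀ ∨ ∃ κ, c.src = (blockIter k c₀).shift κ) → feeds k c ⊆ B := by
    intro c hc b₀ hb₀
    obtain ⟨z, hz, hsrc⟩ := exists_transl_of_mem_feeds hk c₀ c hc hb₀
    exact ⟨z, fun κ => (hz κ).trans (by rw [hr_def]; omega), hsrc⟩
  have hf₁ : feeds k (⟨y, μ⟩ : PBond P k) ⊆ B := hfeed _ (Or.inl hy.symm)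
  have hf₂ : feeds k (⟨y.shift μ, ν⟩ : PBond P k) ⊆ B := hfeed _ (Or.inr ⟨μ, by show y.shift μ = _; rw [hy]⟩)
  have hf₃ : feeds k (⟨y.shift ν, μ⟩ : PBond P k) ⊆ B := hfeed _ (Or.inr ⟨ν, by show y.shift ν = _; rw [hy]⟩)
  have hf₄ : feeds k (⟨y, ν⟩ : PBond P k) ⊆ B := hfeed _ (Or.inl hy.symm)
  -- the one-stroke links lie in the ball (§1)
  have hshift1 : ∀ (z : Site P 0) (κ : Fin P.d), runSite z κ 1 = z.shift κ := fun z κ => by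
    rw [show (1 : ℕ) = 0 + 1 from rfl, runSite_succ, runSite_zero]
  have hlinks : ∀ x ∈ iterBlock k y, ∀ s ∈ Finset.range (P.L ^ k), ∀ t ∈ Finset.range (P.L ^ k),
      (⟨runSite (runSite x μ s) ν t, μ⟩ : PBond P 0) ∈ B ∧ (⟨(runSite (runSite x μ s) ν t).shift μ, ν⟩ : PBond P 0) ∈ B ∧
      (⟨(runSite (runSite x μ s) ν t).shift ν, μ⟩ : PBond P 0) ∈ B ∧ (⟨runSite (runSite x μ s) ν t, ν⟩ : PBond P 0) ∈ B := by
    intro x hx s hs t ht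
    rw [Finset.mem_range] at hs ht
    obtain ⟨z, hz, hzt⟩ := exists_transl_of_mem_iterBlock hk c₀ y hy hx (ne_of_lt hμν) hs ht
    have hz' : ∀ κ, (z κ).natAbs ≤ r := fun κ => (hz κ).trans (by rw [hr_def]; omega)
    have hze : ∀ κ' κ, ((z + B7Prop1Explicit.e κ' : Fin P.d → ℤ) κ).natAbs ≤ r := by
      intro κ' κ
      have h1 := hz κ
      rw [Pi.add_apply, B7Prop1Explicit.e_apply]
      split_ifs
      · rw [hr_def]; omega
      · rw [add_zero, hr_def]; omega
    refine ⟨mem_of hz' hzt μ, mem_of (hze μ) ?_ ν, mem_of (hze ν) ?_ μ, mem_of hz' hzt ν⟩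
    · rw [hzt, transl_add_e]
    · rw [hzt, transl_add_e]
  -- the two analytic rows on the ball
  have h1 := reading_conj_iter_plaqHol_le hk V u B hβ0 hB hguard hN ⟨y, μ, ν, hμν⟩ hf₁ hf₂ hf₃ hf₄
    (fun x hx s hs t ht => by
      obtain ⟨a1, a2, a3, a4⟩ := hlinks x hx s hs t ht
      rw [hshift1, hshift1]
      exact ⟨a1, a2, a3, a4⟩) v _ rfl
  have h2 := abs_mean_reading_sub_mean_lin_le hk W y μ ν hμν hβ0 hβ1
    (fun x hx s hs t ht => by
      obtain ⟨a1, a2, a3, a4⟩ := hlinks x hx s hs t ht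
      exact ⟨hB _ a1, hB _ a2, hB _ a3, hB _ a4⟩) v _ rfl
  -- the two linear readings agree (`runSite z κ 1 = z.shift κ`)
  simp only [hshift1] at h1
  -- the mean of `Φ` is the mean of the plaquette readings of `W`
  have hΦsum : ∑ x ∈ iterBlock k y, ∑ s ∈ Finset.range (P.L ^ k), ∑ t ∈ Finset.range (P.L ^ k), Φ (runSite (runSite x μ s) ν t) μ ν =
      ∑ x ∈ iterBlock k y, ∑ s ∈ Finset.range (P.L ^ k), ∑ t ∈ Finset.range (P.L ^ k),
        ⟪v, imVec (su2Quat (GaugeField.plaqHol W ⟨runSite (runSite x μ s) ν t, μ, ν, hμν⟩))⟫ :=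
    Finset.sum_congr rfl fun x _ => Finset.sum_congr rfl fun s _ => Finset.sum_congr rfl fun t _ => hΦ ⟨_, μ, ν, hμν⟩
  rw [hΦsum]
  -- `|v₀| + |v₁| + |v₂| ≤ √3‖v‖ = √3`
  have hv3 : |v 0| + |v 1| + |v 2| ≤ Real.sqrt 3 := by simpa [hv] using sum_abs_le_sqrt_three_mul_norm v
  exact abs_sub_le_of_two_readings h2 h1 hv3 (by positivity) (by positivity) (by positivity)

/-! ## §3 The door's leaves (S3) and (S4) in the skeleton's letters -/

/-- Real knit for (S4): `|a − c| ≤ B₁ + B₂`, `|c| ≤ x` ⟹ `|a| ≤ x + B₁ + B₂`. [folklore] -/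
private theorem abs_le_of_abs_sub_le {a c x B₁ B₂ : ℝ} (h : |a - c| ≤ B₁ + B₂) (hc : |c| ≤ x) : |a| ≤ x + B₁ + B₂ := by
  have h1 : |a| ≤ |a - c| + |c| := by
    have := abs_add_le (a - c) c
    rwa [sub_add_cancel] at this
  linarith

/-- ★ **(S3) `D6-MEANS(j)` — THE SIGNAL PLAQUETTE.**  In the door's letters: `V` with `PlaqSmall θK V` (the stub's `hfin 0`), the comb centre `c₀ = embIter j p.src`
(so `(axialT V c₀)^{(j)}(p.src) = 1`, ✓`transfUp_axialT_embIter`, and the window statistic is read EXACTLY), `Φ` the antisymmetrised plaquette reading of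
`W̃ = V^{axialT V c₀}` (leaf (S0): `Φ q.src q.μ q.ν = ⟪v, imVec su2Quat(W̃(∂q))⟫`), `‖v‖ = 1`, the guard `81ℓ(4ℓ)^jβ_j ≤ 1` and `j + 2 ≤ m + K`:
`|MEANj − ⟪v, imVec su2Quat(Ū^j[V](∂p))⟫| ≤ √3·(13·βj²)·(L^j)² + √3·(100·((4ℓ)^j)²·βj²)`  (`= … + Ej` of the skeleton).
[cite: Balaban1985Averaging, (11)-(12) p.19, (19)-(20) p.21, Prop. 1 (51) p.26] -/
theorem door_mean_le {j : ℕ} (hj2 : j + 2 ≤ P.m + P.K)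
    (V : GaugeField P 0 (Matrix.specialUnitaryGroup (Fin 2) ℂ)) {θK : ℝ} (hV : PlaqSmall θK V)
    (hguard : 81 * ((((P.d + 2) * P.L : ℕ) : ℝ)) * ((4 * ((((P.d + 2) * P.L : ℕ) : ℝ))) ^ j *
      ((((2 * P.d * (4 * P.L ^ j + 2) + 2 : ℕ) : ℝ) ^ 2 / 4) * θK)) ≤ 1)
    (p : Plaq P j) (c₀ : Site P 0) (hc₀ : c₀ = embIter j p.src)
    (v : EuclideanSpace ℝ (Fin 3)) (hv : ‖v‖ = 1) (Φ : Site P 0 → Fin P.d → Fin P.d → ℝ)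
    (hΦ : ∀ q : Plaq P 0, Φ q.src q.μ q.ν =
      ⟪v, imVec (su2Quat (GaugeField.plaqHol (GaugeField.gaugeAct (axialT V c₀) V) q))⟫) :
    |(((P.L : ℝ) ^ P.d) ^ j)⁻¹ * ∑ x ∈ iterBlock j p.src, ∑ s ∈ Finset.range (P.L ^ j), ∑ t ∈ Finset.range (P.L ^ j),
        Φ (runSite (runSite x p.μ s) p.ν t) p.μ p.ν -
      ⟪v, imVec (su2Quat (GaugeField.plaqHol
        (Averaging.iter (fun i => BlockAveraging.blockAvg (P := P) (j := i) T3UnitLawDensityEML.ℰp) j V) p))⟫| ≤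
      Real.sqrt 3 * (13 * ((((2 * P.d * (4 * P.L ^ j + 2) + 2 : ℕ) : ℝ) ^ 2 / 4) * θK) ^ 2) * ((P.L : ℝ) ^ j) ^ 2 +
      Real.sqrt 3 * (100 * ((4 * ((((P.d + 2) * P.L : ℕ) : ℝ))) ^ j) ^ 2 * ((((2 * P.d * (4 * P.L ^ j + 2) + 2 : ℕ) : ℝ) ^ 2 / 4) * θK) ^ 2) := by
  have hj : j ≤ P.m + P.K := by omega
  have hy : blockIter j c₀ = p.src := by rw [hc₀]; exact blockIter_embIter hj p.src
  have h := abs_mean_sub_reading_conj_le hj2 V hV hguard c₀ p.src hy p.μ p.ν p.hμν v hv Φ hΦ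
  have hu : transfUp (axialT V c₀) j p.src = 1 := by rw [hc₀]; exact transfUp_axialT_embIter V j p.src
  rw [hu, one_mul, inv_one, mul_one] at h
  exact h

/-- ★ **(S4) `D6-MEANS(h)` — THE FAR PLAQUETTE.**  Same `V`, `c₀ = embIter j p.src`, `Φ`, `v`; the far plaquette's source `Y : Site P h` above `p` through the profile
socket's nesting identity `val(p.src i) ∕ L^{h−j} = val(Y i)` (✓`exists_coarsePlaq`, so `blockIter h c₀ = Y`), the guard `81ℓ(4ℓ)^hβ_h ≤ 1`, `h + 2 ≤ m + K`, and the
stub's coarse smallness `PlaqSmall x_h (Ū^h V)` (`hcoarse h`, `x_h = θBal F.L γ (Λb) p₀ (K−h)`): the conjugation by `(axialT V c₀)^{(h)}(Y)` no longer cancels but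
`|⟪v, imVec su2Quat(uXu⁻¹)⟫| ≤ ‖v‖·dist1 X < x_h` (✓`norm_imVec_le_dist1`, `dist1_conj`), whence
`|MEANh| ≤ x_h + √3·(13·βh²)·(L^h)² + √3·(100·((4ℓ)^h)²·βh²)`. [cite: Balaban1985Averaging, (11)-(12) p.19, (19)-(20) p.21, Prop. 1 (51) p.26] -/
theorem door_mean_far_le {j h : ℕ} (hjh : j ≤ h) (hh2 : h + 2 ≤ P.m + P.K)
    (V : GaugeField P 0 (Matrix.specialUnitaryGroup (Fin 2) ℂ)) {θK : ℝ} (hV : PlaqSmall θK V)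
    (hguard : 81 * ((((P.d + 2) * P.L : ℕ) : ℝ)) * ((4 * ((((P.d + 2) * P.L : ℕ) : ℝ))) ^ h *
      ((((2 * P.d * (4 * P.L ^ h + 2) + 2 : ℕ) : ℝ) ^ 2 / 4) * θK)) ≤ 1)
    (p : Plaq P j) (c₀ : Site P 0) (hc₀ : c₀ = embIter j p.src) (Y : Site P h)
    (hnest : ∀ i, (p.src i).val / P.L ^ (h - j) = (Y i).val) {xh : ℝ}
    (hsmall : PlaqSmall xh (Averaging.iter (fun i => BlockAveraging.blockAvg (P := P) (j := i) T3UnitLawDensityEML.ℰp) h V))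
    (v : EuclideanSpace ℝ (Fin 3)) (hv : ‖v‖ = 1) (Φ : Site P 0 → Fin P.d → Fin P.d → ℝ)
    (hΦ : ∀ q : Plaq P 0, Φ q.src q.μ q.ν =
      ⟪v, imVec (su2Quat (GaugeField.plaqHol (GaugeField.gaugeAct (axialT V c₀) V) q))⟫) :
    |(((P.L : ℝ) ^ P.d) ^ h)⁻¹ * ∑ x ∈ iterBlock h Y, ∑ s ∈ Finset.range (P.L ^ h), ∑ t ∈ Finset.range (P.L ^ h),
        Φ (runSite (runSite x p.μ s) p.ν t) p.μ p.ν| ≤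
      xh + Real.sqrt 3 * (13 * ((((2 * P.d * (4 * P.L ^ h + 2) + 2 : ℕ) : ℝ) ^ 2 / 4) * θK) ^ 2) * ((P.L : ℝ) ^ h) ^ 2 +
      Real.sqrt 3 * (100 * ((4 * ((((P.d + 2) * P.L : ℕ) : ℝ))) ^ h) ^ 2 * ((((2 * P.d * (4 * P.L ^ h + 2) + 2 : ℕ) : ℝ) ^ 2 / 4) * θK) ^ 2) := by
  have hh : h ≤ P.m + P.K := by omega
  have hy : blockIter h c₀ = Y := by
    funext i
    apply ZMod.val_injective
    rw [val_blockIter hh, hc₀, val_embIter_div_pow hjh hh, hnest]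
  have hm := abs_mean_sub_reading_conj_le hh2 V hV hguard c₀ Y hy p.μ p.ν p.hμν v hv Φ hΦ
  have hwin : |⟪v, imVec (su2Quat (transfUp (axialT V c₀) h Y *
        GaugeField.plaqHol (Averaging.iter (fun i => BlockAveraging.blockAvg (P := P) (j := i) T3UnitLawDensityEML.ℰp) h V) ⟨Y, p.μ, p.ν, p.hμν⟩ *
        (transfUp (axialT V c₀) h Y)⁻¹))⟫| ≤ xh := by
    refine (abs_real_inner_le_norm _ _).trans ?_
    rw [hv, one_mul]
    refine (norm_imVec_le_dist1 _).trans ?_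
    rw [GaugeGroup.dist1_conj]
    exact (hsmall _).le
  exact abs_le_of_abs_sub_le hm hwin

end Summit.QuantumFields.YangMills.Theorems.CovariantDischargeDoorMeans

end
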